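/-
Copyright (c) 2026. All rights reserved.
Released under Apache 2.0 license as described in the file LICENSE.
-/
import Mathlib
import HarnessLib
import Summits.RiemannHypothesis.RiemannHypothesis.Theorems.EarlyAppointmentsCombGHelpers

/-!
# G bound for CombDescentStep comparison

The comparison bound for Rouché requires |G(z) - G(z₀)| < 2/h on D(z₀, h/2).
Key: G is analytic; bound sup|G| on a larger disc, then use Cauchy → mean value.
-/

open Complex Real Set Filter Topology Metric
open scoped BigOperators Topology ComplexConjugate

noncomputable section

namespace GBound

/-- G is analytic at z₀ when z₀ is a simple zero of f. -/
theorem G_analyticAt_of_simple_zero {f : ℂ → ℂ} {z₀ : ℂ}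
    (hf_diff : Differentiable ℂ f) (hz₀ : f z₀ = 0) (hz₀_simple : deriv f z₀ ≠ 0) :
    AnalyticAt ℂ (EarlyAppointmentsCombGHelpers.G f z₀) z₀ :=
  EarlyAppointmentsCombGHelpers.G_analyticAt_of_simple_zero hf_diff hz₀ hz₀_simple

/-- Analytic functions are continuous. -/
theorem G_continuousAt {f : ℂ → ℂ} {z₀ : ℂ}
    (hf_diff : Differentiable ℂ f) (hz₀ : f z₀ = 0) (hz₀_simple : deriv f z₀ ≠ 0) :
    ContinuousAt (EarlyAppointmentsCombGHelpers.G f z₀) z₀ :=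
  (G_analyticAt_of_simple_zero hf_diff hz₀ hz₀_simple).continuousAt


end GBound

end
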